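import Literature.Geometry.GeometricMeasureTheory.BlowUpCycle
import Literature.Geometry.GeometricMeasureTheory.TopDimensionalRigidity
import Literature.Geometry.GeometricMeasureTheory.CurrentsPushforward
import HarnessLib

/-!
# Projecting the blow-ups of a cycle near one sheet of the blow-up limit

Support file for the proof of the named fact
`Literature.Geometry.GeometricMeasureTheory.Federer1969_compactness_integralCurrents` along
B. White's structure-theorem-free proof of the closure theorem, Step 3 of [White1989, pp. 218–219]
(the projection argument; [Bandara2006, proof of Thm. 4.2.1, pp. 42–44]). Setting of
`BlowUpCycle`: `σ` finite, `ξ` integrable, `T = σ ∧ ξ` a cycle, blow-ups `T_l = T_{a,λ_l}` with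
`σ_{a,λ_l} → ν` vaguely, `a` a normalised Lebesgue point of `ξ`, `W = W_{ξ(a)}` the invariant
subspace (of dimension `k + 1`, so that `ξ(a) = c₀ · e₀ ∧ ⋯ ∧ e_k` for an orthonormal frame `e` of
`W`, `c₀ = ⟨e^♭, ξ(a)⟩`), and an isolated sheet `z ∈ Wᗮ` of `ν`:
`ν ⌞ {x : dist(P_{Wᗮ} x, z) < δ} = α · 𝓗^{k+1} ⌞ (z + W)` (`TranslationInvariantMeasures`).

White restricts `T_λ` to a sharp slab `R_t` around the sheet and pushes forward by the orthogonal
projection `Π` onto `W`; the boundary of the piece is controlled by the slicing lemma. Here the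
sharp slab is replaced by a SMOOTH cutoff `G` (`= 1` near `{‖Π x‖ ≤ R, dist(P_{Wᗮ} x, z) ≤ ε}`,
supported in `{‖Π x‖ < 2R, dist(P_{Wᗮ} x, z) < 2ε}`, `2ε < δ`; `exists_sheetCutoff`), which makes
the slicing lemma unnecessary: for the projected currents `S_l = Π_# (T_l ⌞ G)` on `W`,

* `Current.boundary_pushforward_smulFun_apply_of_cycle` — `∂S_l(ψ) = −T_l(dG ∧ Π^# ψ)` (`T_l` is
  a cycle), whence `Current.abs_boundary_pushforward_smulFun_le` — for `ψ` supported in the disc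
  `B_W(0, R)`: `|∂S_l(ψ)| ≤ (k+1) ‖dG‖_∞ ‖ψ‖_∞ ‖T_l‖(K_shell)` with the compact shell
  `K_shell = {‖Π x‖ ≤ R, ε ≤ dist(P_{Wᗮ} x, z) ≤ 2ε}`, a `ν`-null set
  (`measure_cylinderShell_eq_zero_of_sheet`), so that `‖T_l‖(K_shell) → 0`
  (`tendsto_variation_blowUpCurrent_of_null`);
* `Current.mass_pushforward_smulFun_le` — `𝐌(S_l) ≤ ‖T_l‖(spt G)`, eventually bounded;
* `pushforward_smulFun_vectorCurrent_apply_smul_frameCovector` — the integral formula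
  `S_l(g e^♭) = ∫ G χ (g ∘ Π) ⟨e^♭, ξ_l⟩ dσ_l` (`Π^# e^♭ = e^♭`,
  `frameCovector_compContinuousLinearMap_orthogonalProjectionOnto`);
* `tendsto_projectedBlowUp_apply` — `S_l(g · e^♭) → α c₀ ∫_W g` for `g` supported in `B_W(0, R)`
  (cone limit `T_l ⇀ ν ∧ ξ(a)`, the sheet structure, and `𝓗^{k+1} ⌞ (z + W) ≅ vol_W`,
  `integral_comp_orthogonalProjectionOnto_restrict_plane`);
* **`eventually_forall_abs_projectedBlowUp_sub_le`** — by `TopDimensionalRigidity`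
  (`eventually_forall_abs_apply_sub_const_integral_le`): for `U'` compactly inside `B_W(0, R)` and
  `η > 0`, for all large `l`, `|S_l(g · e^♭) − α c₀ ∫_W g| ≤ η` for all test functions `g`
  supported in `U'` with `|g| ≤ 1` — White's "`𝐌_U(T'_λ − β_λ [U]) → 0`" with `β = α c₀`.

Theorems only; no definitions, no named facts.

## References

* B. White, *A new proof of the compactness theorem for integral currents*, Comment. Math.
  Helv. 64 (1989) 207–220, pp. 218–219 [White1989].
* L. Bandara, *The closure theorem for integral currents without the structure theorem*,
  B.Sc. thesis, ANU 2006, Lemma 4.1.12 and proof of Thm. 4.2.1, pp. 42–44 (held copy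
  `lit paper:galaxy-pdf-8023002039701172160`) [Bandara2006].
* H. Federer, *Geometric Measure Theory*, Springer 1969, 4.1.7 [Federer1969].
-/

noncomputable section

open scoped Distributions ENNReal NNReal Topology ContDiff RealInnerProductSpace Pointwise
open MeasureTheory TopologicalSpace Set Filter Metric Function

namespace Literature.Geometry.GeometricMeasureTheory

-- Nested operator-norm instances on (duals of) `E [⋀^Fin m]→L[ℝ] ℝ`, as in `Currents.lean`.
set_option maxSynthPendingDepth 3

variable {V : Type*} [NormedAddCommGroup V] [InnerProductSpace ℝ V] [FiniteDimensional ℝ V]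
  [MeasurableSpace V] [BorelSpace V] {k : ℕ}

/-! ### Frames of a subspace, pulled back along the orthogonal projection -/

section Frame

omit [FiniteDimensional ℝ V] [MeasurableSpace V] [BorelSpace V] in
/-- An orthonormal frame of a subspace is orthonormal in the ambient space.
[cite: Federer1969, 1.7.5] -/
theorem orthonormal_subtype_val_comp {m : ℕ} {W : Submodule ℝ V} {e : Fin m → W}
    (he : Orthonormal ℝ e) : Orthonormal ℝ (fun i => (e i : V)) :=
  (W.subtypeₗᵢ.orthonormal_comp_iff).2 he

omit [MeasurableSpace V] [BorelSpace V] in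
/-- **`Π^# e^♭ = e^♭`**: the dual covector of a frame `e` of `W`, pulled back along the orthogonal
projection `Π : V → W`, is the dual covector of the same frame viewed in `V`
(`⟪e_j, Π v⟫ = ⟪e_j, v⟫`). [cite: Federer1969, 1.7.5] -/
theorem frameCovector_compContinuousLinearMap_orthogonalProjectionOnto {m : ℕ}
    (W : Submodule ℝ V) (e : Fin m → W) :
    (frameCovector e).compContinuousLinearMap W.orthogonalProjectionOnto =
      frameCovector (fun i => (e i : V)) := by
  ext v
  rw [ContinuousAlternatingMap.compContinuousLinearMap_apply, frameCovector_apply,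
    frameCovector_apply]
  congr 1
  ext i j
  simp only [Matrix.of_apply, comp_apply]
  exact Submodule.inner_orthogonalProjectionOnto_eq_of_mem_left (e j) (v i)

omit [FiniteDimensional ℝ V] [MeasurableSpace V] [BorelSpace V] in
/-- `(c • ω) ∘ ⋀ᵐA = c • (ω ∘ ⋀ᵐA)` (linearity of the pull-back of covectors).
[cite: Federer1969, 4.1.6] -/
theorem Covector.smul_compContinuousLinearMap {m : ℕ} {W : Submodule ℝ V} (c : ℝ)
    (η : Covector W m) (A : V →L[ℝ] W) :
    (c • η).compContinuousLinearMap A = c • η.compContinuousLinearMap A := by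
  ext v
  simp [ContinuousAlternatingMap.compContinuousLinearMap_apply]

end Frame

/-! ### Integration over an affine plane `z + W` through the projection -/

section Plane

omit [FiniteDimensional ℝ V] [MeasurableSpace V] [BorelSpace V] in
/-- The translate `w ↦ z + w` of the inclusion of `W` is an isometry onto `z + W`. [folklore] -/
private theorem isometry_add_subtype_val (W : Submodule ℝ V) (z : V) :
    Isometry (fun w : W => z + (w : V)) :=
  Isometry.of_dist_eq fun w w' => by
    rw [dist_eq_norm, dist_eq_norm, add_sub_add_left_eq_sub, ← Submodule.coe_sub, Submodule.coe_norm]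

omit [FiniteDimensional ℝ V] [MeasurableSpace V] [BorelSpace V] in
/-- The range of `w ↦ z + w` is the affine plane `{x : x − z ∈ W}`. [folklore] -/
private theorem range_add_subtype_val (W : Submodule ℝ V) (z : V) :
    range (fun w : W => z + (w : V)) = {x | x - z ∈ W} := by
  ext x
  constructor
  · rintro ⟨w, rfl⟩
    simp
  · intro hx
    exact ⟨⟨x - z, hx⟩, by simp⟩

/-- **`∫_{z+W} h(Π x) d𝓗^{d}(x) = ∫_W h d vol`** for `z ∈ Wᗮ`, `d = dim W`: the Euclidean Hausdorff
measure on the affine plane `z + W` is the image of Lebesgue measure of `W` under the isometry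
`w ↦ z + w`, and `Π(z + w) = w`. [cite: Federer1969, 2.10.35, 3.2.3] -/
theorem integral_comp_orthogonalProjectionOnto_restrict_plane (W : Submodule ℝ V) {d : ℕ}
    (hdim : Module.finrank ℝ W = d) {z : V} (hz : z ∈ Wᗮ) (h : W → ℝ) :
    ∫ x in {x | x - z ∈ W}, h (W.orthogonalProjectionOnto x) ∂(μHE[d] : Measure V) =
      ∫ w, h w ∂(volume : Measure W) := by
  have hι := isometry_add_subtype_val W z
  have hme : MeasurableEmbedding (fun w : W => z + (w : V)) :=
    hι.isClosedEmbedding.measurableEmbedding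
  rw [← range_add_subtype_val W z, ← hι.map_euclideanHausdorffMeasure, hme.integral_map]
  have hvol : (μHE[d] : Measure W) = volume := by
    rw [← hdim]; exact InnerProductSpace.euclideanHausdorffMeasure_eq_volume
  rw [hvol]
  refine integral_congr_ae (Eventually.of_forall fun w => ?_)
  simp only
  rw [map_add, Submodule.orthogonalProjectionOnto_apply_of_mem_orthogonal hz, zero_add,
    Submodule.orthogonalProjectionOnto_mem_subspace_eq_self]

/-- The same for lower integrals of `ℝ≥0∞`-valued functions. [cite: Federer1969, 2.10.35] -/
theorem lintegral_comp_orthogonalProjectionOnto_restrict_plane (W : Submodule ℝ V) {d : ℕ}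
    (hdim : Module.finrank ℝ W = d) {z : V} (hz : z ∈ Wᗮ) (h : W → ℝ≥0∞) :
    ∫⁻ x in {x | x - z ∈ W}, h (W.orthogonalProjectionOnto x) ∂(μHE[d] : Measure V) =
      ∫⁻ w, h w ∂(volume : Measure W) := by
  have hι := isometry_add_subtype_val W z
  have hme : MeasurableEmbedding (fun w : W => z + (w : V)) :=
    hι.isClosedEmbedding.measurableEmbedding
  rw [← range_add_subtype_val W z, ← hι.map_euclideanHausdorffMeasure, hme.lintegral_map]
  have hvol : (μHE[d] : Measure W) = volume := by
    rw [← hdim]; exact InnerProductSpace.euclideanHausdorffMeasure_eq_volume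
  rw [hvol]
  refine lintegral_congr fun w => ?_
  rw [map_add, Submodule.orthogonalProjectionOnto_apply_of_mem_orthogonal hz, zero_add,
    Submodule.orthogonalProjectionOnto_mem_subspace_eq_self]

/-- Measure version: `𝓗^d ⌞ (z + W)` of a cylinder set `Π⁻¹(B)` is `vol_W(B)`.
[cite: Federer1969, 2.10.35] -/
theorem euclideanHausdorffMeasure_restrict_plane_preimage (W : Submodule ℝ V) {d : ℕ}
    (hdim : Module.finrank ℝ W = d) {z : V} (hz : z ∈ Wᗮ) {B : Set W} (hB : MeasurableSet B) :
    (μHE[d] : Measure V).restrict {x | x - z ∈ W} (W.orthogonalProjectionOnto ⁻¹' B) =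
      volume B := by
  rw [← lintegral_indicator_one hB, ← lintegral_comp_orthogonalProjectionOnto_restrict_plane W hdim hz,
    ← lintegral_indicator_one (W.orthogonalProjectionOnto.continuous.measurable hB)]
  rfl

end Plane

/-! ### The smooth slab-and-cylinder cutoff around one sheet -/

section Cutoff

omit [MeasurableSpace V] [BorelSpace V] in
/-- `‖x‖ ≤ ‖P_W x‖ + ‖P_{Wᗮ} x‖`. [folklore] -/
private theorem norm_le_norm_starProjection_add (W : Submodule ℝ V) (x : V) :
    ‖x‖ ≤ ‖W.starProjection x‖ + ‖Wᗮ.starProjection x‖ := by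
  conv_lhs => rw [← Submodule.starProjection_add_starProjection_orthogonal (K := W) x]
  exact norm_add_le _ _

omit [MeasurableSpace V] [BorelSpace V] in
/-- The closed slab-and-cylinder `{‖P_W x‖ ≤ R, dist(P_{Wᗮ} x, z) ≤ ε}`... and more generally the
sets `{‖P_W x‖ ≤ R, s ≤ dist(P_{Wᗮ} x, z) ≤ t}` are compact (Bandara: "`W̄` is compact").
[cite: Bandara2006, p. 42] -/
theorem isCompact_cylinderShell (W : Submodule ℝ V) (z : V) (R s t : ℝ) :
    IsCompact {x : V | ‖W.starProjection x‖ ≤ R ∧ s ≤ dist (Wᗮ.starProjection x) z ∧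
      dist (Wᗮ.starProjection x) z ≤ t} := by
  refine Metric.isCompact_of_isClosed_isBounded ?_ ?_
  · refine (isClosed_le (W.starProjection.continuous.norm) continuous_const).inter
      ((isClosed_le continuous_const (Wᗮ.starProjection.continuous.dist continuous_const)).inter
        (isClosed_le (Wᗮ.starProjection.continuous.dist continuous_const) continuous_const))
  · refine (isBounded_iff_forall_norm_le).2 ⟨R + (t + ‖z‖), fun x hx => ?_⟩
    obtain ⟨h1, -, h3⟩ := hx
    calc ‖x‖ ≤ ‖W.starProjection x‖ + ‖Wᗮ.starProjection x‖ := norm_le_norm_starProjection_add W x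
      _ ≤ R + (t + ‖z‖) := by
          gcongr
          calc ‖Wᗮ.starProjection x‖ = ‖(Wᗮ.starProjection x - z) + z‖ := by rw [sub_add_cancel]
            _ ≤ ‖Wᗮ.starProjection x - z‖ + ‖z‖ := norm_add_le _ _
            _ ≤ t + ‖z‖ := by rw [← dist_eq_norm]; gcongr

omit [MeasurableSpace V] [BorelSpace V] in
/-- **The smooth cutoff around one sheet.** For `ε, R > 0` there is a test function `G` on `V`
with `0 ≤ G ≤ 1`, `G = 1` on an open set containing `{‖P_W x‖ ≤ R, dist(P_{Wᗮ} x, z) ≤ ε}`, and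
`spt G ⊆ {‖P_W x‖ < 2R, dist(P_{Wᗮ} x, z) < 2ε}` (smooth Urysohn lemma). It replaces the sharp
slab `R_t = {dist(·, P_j) < t}` of [White1989, p. 219]. [cite: White1989, p. 219] -/
theorem exists_sheetCutoff (W : Submodule ℝ V) (z : V) {ε R : ℝ} (hε : 0 < ε) (hR : 0 < R) :
    ∃ G : 𝓓((⊤ : Opens V), ℝ), (∀ x, G x ∈ Icc (0 : ℝ) 1) ∧
      (∃ O : Set V, IsOpen O ∧
        {x : V | ‖W.starProjection x‖ ≤ R ∧ dist (Wᗮ.starProjection x) z ≤ ε} ⊆ O ∧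
        ∀ x ∈ O, G x = 1) ∧
      tsupport ⇑G ⊆ {x : V | ‖W.starProjection x‖ < 2 * R ∧ dist (Wᗮ.starProjection x) z < 2 * ε} := by
  set K : Set V := {x : V | ‖W.starProjection x‖ ≤ R ∧ dist (Wᗮ.starProjection x) z ≤ ε} with hK
  set O₂ : Set V := {x : V | ‖W.starProjection x‖ < 2 * R ∧ dist (Wᗮ.starProjection x) z < 2 * ε}
    with hO₂
  have hO₂o : IsOpen O₂ :=
    (isOpen_lt W.starProjection.continuous.norm continuous_const).inter
      (isOpen_lt (Wᗮ.starProjection.continuous.dist continuous_const) continuous_const)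
  have hKc : IsCompact K := by
    have h := isCompact_cylinderShell W z R 0 ε
    convert h using 1
    ext x
    simp only [hK, mem_setOf_eq]
    constructor
    · rintro ⟨h1, h2⟩; exact ⟨h1, dist_nonneg, h2⟩
    · rintro ⟨h1, -, h2⟩; exact ⟨h1, h2⟩
  have hKO₂ : K ⊆ O₂ := fun x hx => ⟨by linarith [hx.1], by linarith [hx.2]⟩
  obtain ⟨χ, O, hO, hKO, hχ1, hχ01⟩ :=
    exists_testFunction_eq_one_nhds (Ω := ⟨O₂, hO₂o⟩) hKc hKO₂
  set G : 𝓓((⊤ : Opens V), ℝ) := TestFunction.monoCLM ℝ χ with hG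
  have hGχ : (G : V → ℝ) = χ := by
    rw [hG, TestFunction.monoCLM_apply, if_pos ⟨le_rfl, le_top⟩]
  refine ⟨G, fun x => ?_, ⟨O, hO, hKO, fun x hx => ?_⟩, ?_⟩
  · rw [hGχ]; exact hχ01 x
  · rw [hGχ]; exact hχ1 x hx
  · rw [hGχ]; exact χ.tsupport_subset

end Cutoff

/-! ### The projected cut-off blow-ups `S_l = Π_# (T_l ⌞ G)` -/

section Projected

variable {σ : Measure V} {ξ : V → Multivector V (k + 1)} {a : V} {lam : ℕ → ℝ} {ν : Measure V}

omit [InnerProductSpace ℝ V] [FiniteDimensional ℝ V] [MeasurableSpace V] [BorelSpace V] in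
/-- The support of `T ⌞ G` lies in `spt G`. [cite: Federer1969, 4.1.7] -/
theorem Current.support_smulFun_subset_tsupport [NormedSpace ℝ V] {Ω : Opens V} {m : ℕ}
    (T : Current Ω m) (G : 𝓓(Ω, ℝ)) :
    (T.smulFun G.contDiff).support ⊆ tsupport ⇑G := by
  intro x hx
  by_contra hxG
  obtain ⟨φ, hφU, hφT⟩ := hx.2 _ ((isClosed_tsupport _).isOpen_compl.mem_nhds hxG)
  refine hφT ?_
  rw [Current.smulFun_apply]
  have : TestForm.smulFun G.contDiff φ = 0 := by
    apply TestFunction.ext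
    intro y
    rw [TestForm.smulFun_apply]
    change G y • φ y = 0
    by_cases hy : y ∈ tsupport ⇑G
    · have : y ∉ tsupport ⇑φ := fun h => hφU h hy
      rw [image_eq_zero_of_notMem_tsupport this, smul_zero]
    · rw [image_eq_zero_of_notMem_tsupport hy, zero_smul]
  rw [this, map_zero]

omit [MeasurableSpace V] [BorelSpace V] in
/-- **`∂ Π_#(T ⌞ G) (ψ) = −T(dG ∧ Π^#_χ ψ)` for a cycle `T`**: `∂Π_# = Π_#∂` (the cutoff `χ` being
`1` near `spt G ⊇ spt (T ⌞ G)`) and `∂(T ⌞ G) = (∂T) ⌞ G − T ⌞ dG = −T ⌞ dG`.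
[cite: Federer1969, 4.1.7] -/
theorem Current.boundary_pushforward_smulFun_apply_of_cycle (W : Submodule ℝ V)
    (T : Current (⊤ : Opens V) (k + 1)) (hT : T.boundary = 0) (G χ : 𝓓((⊤ : Opens V), ℝ))
    {U₀ : Set V} (hU₀ : IsOpen U₀) (hGU₀ : tsupport ⇑G ⊆ U₀) (hχ : ∀ x ∈ U₀, χ x = 1)
    (ψ : TestForm (⊤ : Opens W) k) :
    (((T.smulFun G.contDiff).pushforward ⊤ χ W.orthogonalProjectionOnto.contDiff).boundary ψ) =
      -T (TestForm.wedgeD G.contDiff (TestForm.pullback χ W.orthogonalProjectionOnto.contDiff ψ)) := by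
  rw [Current.boundary_pushforward _ χ _ hU₀ ((T.support_smulFun_subset_tsupport G).trans hGU₀) hχ,
    Current.pushforward_apply, Current.boundary_smulFun, hT]
  simp [Current.wedgeD_apply]

/-- **Boundary estimate on the cylinder base.** Let `T` be a cycle of finite mass, `G` a cutoff
with `G = 1` on an open `O ⊇ {‖P_W x‖ ≤ R, dist(P_{Wᗮ} x, z) ≤ ε}` and
`spt G ⊆ {dist(P_{Wᗮ} x, z) < 2ε}`, `|χ| ≤ 1`. Then for every test form `ψ` on `W` supported in the
disc `B(0, R)` with `‖ψ‖ ≤ C'`: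
`|∂ Π_#(T ⌞ G)(ψ)| ≤ (k+1) · sup ‖dG‖ · ‖T‖(K_shell) · C'`, where
`K_shell = {‖P_W x‖ ≤ R, ε ≤ dist(P_{Wᗮ} x, z) ≤ 2ε}` (the form `dG ∧ Π^# ψ` lives on the shell).
[cite: White1989, p. 219; Bandara2006, Lemma 4.1.11] -/
theorem Current.abs_boundary_pushforward_smulFun_le (W : Submodule ℝ V)
    (T : Current (⊤ : Opens V) (k + 1)) (hTm : T.mass ≠ ⊤) (hT : T.boundary = 0)
    (G χ : 𝓓((⊤ : Opens V), ℝ)) {z : V} {ε R : ℝ}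
    {O : Set V} (hO : IsOpen O)
    (hKO : {x : V | ‖W.starProjection x‖ ≤ R ∧ dist (Wᗮ.starProjection x) z ≤ ε} ⊆ O)
    (hG1 : ∀ x ∈ O, G x = 1)
    (hGsupp : tsupport ⇑G ⊆ {x : V | dist (Wᗮ.starProjection x) z < 2 * ε})
    {U₀ : Set V} (hU₀ : IsOpen U₀) (hGU₀ : tsupport ⇑G ⊆ U₀) (hχ : ∀ x ∈ U₀, χ x = 1)
    (hχ1 : ∀ x, |χ x| ≤ 1) {B : ℝ} (hB : ∀ x, ‖fderiv ℝ (G : V → ℝ) x‖ ≤ B)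
    (ψ : TestForm (⊤ : Opens W) k) {C' : ℝ} (hψU : tsupport ⇑ψ ⊆ ball (0 : W) R)
    (hψC : ∀ y, ‖ψ y‖ ≤ C') :
    |((T.smulFun G.contDiff).pushforward ⊤ χ W.orthogonalProjectionOnto.contDiff).boundary ψ| ≤
      ((k + 1) * B * (T.variation {x : V | ‖W.starProjection x‖ ≤ R ∧
        ε ≤ dist (Wᗮ.starProjection x) z ∧ dist (Wᗮ.starProjection x) z ≤ 2 * ε}).toReal) * C' := by
  set P := W.orthogonalProjectionOnto with hPdef
  set Ksh : Set V := {x : V | ‖W.starProjection x‖ ≤ R ∧ ε ≤ dist (Wᗮ.starProjection x) z ∧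
    dist (Wᗮ.starProjection x) z ≤ 2 * ε} with hKsh
  have hKshc : IsCompact Ksh := isCompact_cylinderShell W z R ε (2 * ε)
  have hKshm : MeasurableSet Ksh := hKshc.isClosed.measurableSet
  have hTr : T.IsRepresentable := T.isRepresentable_of_mass_ne_top hTm
  haveI : IsFiniteMeasure T.variation := T.isFiniteMeasure_variation hTm
  -- `C' ≥ 0` (the space `W` is nonempty)
  have hC' : 0 ≤ C' := (norm_nonneg _).trans (hψC 0)
  have hB0 : 0 ≤ B := (norm_nonneg _).trans (hB 0)
  rw [T.boundary_pushforward_smulFun_apply_of_cycle W hT G χ hU₀ hGU₀ hχ ψ, abs_neg]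
  set frm := TestForm.wedgeD G.contDiff (TestForm.pullback χ P.contDiff ψ) with hfrm
  -- pointwise bound and support of `ω`
  have hθ : ∀ x, ‖TestForm.pullback χ P.contDiff ψ x‖ ≤ ‖ψ (P x)‖ := by
    intro x
    refine (TestForm.norm_pullback_apply_le χ P.contDiff ψ x).trans ?_
    rw [ContinuousLinearMap.fderiv]
    calc |χ x| * ‖ψ (P x)‖ * ‖P‖ ^ k ≤ 1 * ‖ψ (P x)‖ * 1 ^ k := by
          gcongr
          · exact hχ1 x
          · exact Submodule.orthogonalProjectionOnto_norm_le W
      _ = ‖ψ (P x)‖ := by rw [one_mul, one_pow, mul_one]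
  have hfrmle : ∀ x, ‖frm x‖ ≤ (k + 1) * B * C' := by
    intro x
    calc ‖frm x‖ ≤ (k + 1) * ‖fderiv ℝ (G : V → ℝ) x‖ * ‖TestForm.pullback χ P.contDiff ψ x‖ :=
          TestForm.norm_wedgeD_apply_le G.contDiff _ x
      _ ≤ (k + 1) * B * C' := by
          gcongr
          · exact hB x
          · exact (hθ x).trans (hψC _)
  have hfrmzero : ∀ x ∉ Ksh, frm x = 0 := by
    intro x hx
    -- either `dG(x) = 0` or `ψ(Π x) = 0`
    have hfrmx : ‖frm x‖ ≤ (k + 1) * ‖fderiv ℝ (G : V → ℝ) x‖ * ‖ψ (P x)‖ :=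
      (TestForm.norm_wedgeD_apply_le G.contDiff _ x).trans (by gcongr; exact hθ x)
    by_cases hψx : ψ (P x) = 0
    · rw [hψx, norm_zero, mul_zero] at hfrmx
      exact norm_le_zero_iff.1 hfrmx
    have hPx0 : ‖W.starProjection x‖ ≤ R := by
      have h1 : P x ∈ tsupport ⇑ψ := subset_tsupport _ hψx
      have h2 := hψU h1
      rw [mem_ball, dist_zero_right] at h2
      rw [Submodule.starProjection_apply, Submodule.norm_coe]
      exact h2.le
    by_cases hdG : fderiv ℝ (G : V → ℝ) x = 0
    · rw [hdG, norm_zero, mul_zero, zero_mul] at hfrmx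
      exact norm_le_zero_iff.1 hfrmx
    -- `dG(x) ≠ 0`: then `x ∈ spt G` and `x ∉ O`
    have hxG : x ∈ tsupport ⇑G := by
      by_contra h
      have : (G : V → ℝ) =ᶠ[𝓝 x] fun _ => 0 := by
        rw [notMem_tsupport_iff_eventuallyEq] at h; exact h
      exact hdG (by rw [this.fderiv_eq, fderiv_const_apply])
    have hxO : x ∉ O := by
      intro h
      have : (G : V → ℝ) =ᶠ[𝓝 x] fun _ => 1 :=
        Filter.eventually_of_mem (hO.mem_nhds h) hG1
      exact hdG (by rw [this.fderiv_eq, fderiv_const_apply])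
    exfalso
    refine hx ⟨hPx0, ?_, (hGsupp hxG).le⟩
    by_contra hlt
    exact hxO (hKO ⟨hPx0, (not_le.1 hlt).le⟩)
  -- integrate against `‖T‖`
  have hle : ∫⁻ x, ‖frm x‖ₑ ∂T.variation ≤ ENNReal.ofReal ((k + 1) * B * C') * T.variation Ksh := by
    calc ∫⁻ x, ‖frm x‖ₑ ∂T.variation
        ≤ ∫⁻ x, Ksh.indicator (fun _ => ENNReal.ofReal ((k + 1) * B * C')) x ∂T.variation := by
          refine lintegral_mono fun x => ?_
          by_cases hx : x ∈ Ksh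
          · rw [indicator_of_mem hx, ← ofReal_norm]
            exact ENNReal.ofReal_le_ofReal (hfrmle x)
          · rw [indicator_of_notMem hx, hfrmzero x hx, enorm_zero]
      _ = ENNReal.ofReal ((k + 1) * B * C') * T.variation Ksh := by
          rw [lintegral_indicator hKshm, setLIntegral_const]
  have hfin : ENNReal.ofReal ((k + 1) * B * C') * T.variation Ksh ≠ ⊤ :=
    ENNReal.mul_ne_top ENNReal.ofReal_ne_top (measure_ne_top _ _)
  calc |T frm| ≤ (∫⁻ x, ‖frm x‖ₑ ∂T.variation).toReal := hTr.abs_apply_le_lintegral frm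
    _ ≤ (ENNReal.ofReal ((k + 1) * B * C') * T.variation Ksh).toReal :=
        ENNReal.toReal_mono hfin hle
    _ = (k + 1) * B * (T.variation Ksh).toReal * C' := by
        rw [ENNReal.toReal_mul, ENNReal.toReal_ofReal (by positivity)]
        ring

/-- **Mass of the cut-off push-forward**: `𝐌(Π_#(T ⌞ G)) ≤ ‖T‖(spt G)` for `0 ≤ G ≤ 1`,
`|χ| ≤ 1` (`Π` is `1`-Lipschitz). [cite: Federer1969, 4.1.7] -/
theorem Current.mass_pushforward_smulFun_le (W : Submodule ℝ V)
    (T : Current (⊤ : Opens V) (k + 1)) (hTm : T.mass ≠ ⊤) (G χ : 𝓓((⊤ : Opens V), ℝ))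
    (hG01 : ∀ x, G x ∈ Icc (0 : ℝ) 1) (hχ1 : ∀ x, |χ x| ≤ 1) :
    ((T.smulFun G.contDiff).pushforward ⊤ χ W.orthogonalProjectionOnto.contDiff).mass ≤
      T.variation (tsupport ⇑G) := by
  set P := W.orthogonalProjectionOnto with hPdef
  have hTr : T.IsRepresentable := T.isRepresentable_of_mass_ne_top hTm
  have h1 : ((T.smulFun G.contDiff).pushforward ⊤ χ P.contDiff).mass ≤
      ((1 : ℝ≥0) : ℝ≥0∞) ^ (k + 1) * (T.smulFun G.contDiff).mass :=
    Current.mass_pushforward_le _ hχ1 P.contDiff (L := 1) fun x _ => by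
      rw [ContinuousLinearMap.fderiv, NNReal.coe_one]
      exact Submodule.orthogonalProjectionOnto_norm_le W
  rw [ENNReal.coe_one, one_pow, one_mul] at h1
  refine h1.trans (iSup₂_le fun φ hφ => ?_)
  rw [Current.smulFun_apply]
  refine (hTr.ofReal_apply_le_lintegral _).trans ?_
  have hGm : MeasurableSet (tsupport ⇑G) := (isClosed_tsupport _).measurableSet
  calc ∫⁻ x, ‖TestForm.smulFun G.contDiff φ x‖ₑ ∂T.variation
      ≤ ∫⁻ x, (tsupport ⇑G).indicator (fun _ => (1 : ℝ≥0∞)) x ∂T.variation := by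
        refine lintegral_mono fun x => ?_
        rw [TestForm.smulFun_apply]
        by_cases hx : x ∈ tsupport ⇑G
        · rw [indicator_of_mem hx, ← ofReal_norm, norm_smul, Real.norm_eq_abs,
            abs_of_nonneg (hG01 x).1]
          refine ENNReal.ofReal_le_one.2 ?_
          calc G x * ‖φ x‖ ≤ 1 * 1 := by
                gcongr
                · exact (hG01 x).2
                · exact hφ x
            _ = 1 := one_mul _
        · rw [indicator_of_notMem hx, image_eq_zero_of_notMem_tsupport hx, zero_smul, enorm_zero]
    _ = T.variation (tsupport ⇑G) := by
        rw [lintegral_indicator hGm, setLIntegral_const, one_mul]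

/-- **Evaluation of the projected current on `g · e^♭`**: with `T = μ ∧ F` (locally integrable
`F`), `Π_#(T ⌞ G)(g e^♭) = ∫ G(x) χ(x) g(Π x) ⟨e^♭, F(x)⟩ dμ(x)` where `e^♭` on the right is the
dual covector of the frame `e` viewed in `V` (`Π^# e^♭ = e^♭`). [cite: Federer1969, 4.1.7] -/
theorem pushforward_smulFun_vectorCurrent_apply_smul_frameCovector (W : Submodule ℝ V)
    {μ : Measure V} {F : V → Multivector V (k + 1)}
    (hF : LocallyIntegrableOn F ((⊤ : Opens V) : Set V) μ) (G χ : 𝓓((⊤ : Opens V), ℝ))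
    (e : Fin (k + 1) → W) (g : 𝓓((⊤ : Opens W), ℝ)) :
    (((vectorCurrent μ F : Current (⊤ : Opens V) (k + 1)).smulFun G.contDiff).pushforward ⊤ χ
        W.orthogonalProjectionOnto.contDiff) (smulCovectorCLM (frameCovector e) g) =
      ∫ x, G x * χ x * g (W.orthogonalProjectionOnto x) *
        F x (frameCovector fun i => (e i : V)) ∂μ := by
  rw [Current.pushforward_apply, Current.smulFun_apply, vectorCurrent_apply hF]
  refine integral_congr_ae (Eventually.of_forall fun x => ?_)
  simp only [TestForm.smulFun_apply, TestForm.pullback_apply, smulCovectorCLM_apply,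
    ContinuousLinearMap.fderiv, Covector.smul_compContinuousLinearMap,
    frameCovector_compContinuousLinearMap_orthogonalProjectionOnto, map_smul, smul_eq_mul]
  ring

variable [IsFiniteMeasure σ] [IsLocallyFiniteMeasure ν]

/-- **Weak limit of the projected cut-off blow-ups.** Let `σ_{a,λ_l} → ν` vaguely, `a` a
normalised Lebesgue point of `ξ`, `W` a subspace of dimension `k + 1` with orthonormal basis `e`,
`c₀ = ⟨e^♭, ξ(a)⟩`, and let `z ∈ Wᗮ` be a sheet with `ν ⌞ {dist(P_{Wᗮ} ·, z) < δ} = α 𝓗^{k+1} ⌞ (z+W)`.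
If `G = 1` on an open `O ⊇ {‖P_W x‖ ≤ R, dist(P_{Wᗮ} x, z) ≤ ε}`, `spt G ⊆ {dist(P_{Wᗮ}·, z) < 2ε}`,
`2ε < δ`, and `χ = 1` near `spt G`, then for every test function `g` on `W` supported in
`B(0, R)`: `Π_#(T_l ⌞ G)(g e^♭) → α c₀ ∫_W g`. (In the application `W = W_{ξ(a)}` is the invariant
subspace and `ξ(a) = c₀ e₀ ∧ ⋯ ∧ e_k`.) [cite: White1989, p. 219; Bandara2006, p. 43] -/
theorem tendsto_projectedBlowUp_apply (hξ : Integrable ξ σ) (hlam : ∀ l, 0 < lam l)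
    (hlam0 : Tendsto lam atTop (𝓝 0))
    (hv : Measure.VagueTendsto (fun l => Measure.blowUp σ (k + 1) a (lam l)) ν)
    (hLeb : Tendsto (fun r => (r⁻¹) ^ (k + 1) * ∫ x in closedBall a r, ‖ξ x - ξ a‖ ∂σ)
      (𝓝[>] 0) (𝓝 0))
    (W : Submodule ℝ V) (hdim : Module.finrank ℝ W = k + 1)
    (e : OrthonormalBasis (Fin (k + 1)) ℝ W)
    {z : V} (hz : z ∈ Wᗮ) {δ : ℝ} {α : ℝ≥0}
    (hsheet : ν.restrict {x | dist (Wᗮ.starProjection x) z < δ} =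
      (α : ℝ≥0∞) • (μHE[k + 1] : Measure V).restrict {x | x - z ∈ W})
    {ε R : ℝ} (hε : 0 < ε) (h2ε : 2 * ε < δ) (G χ : 𝓓((⊤ : Opens V), ℝ)) {O : Set V}
    (hKO : {x : V | ‖W.starProjection x‖ ≤ R ∧ dist (Wᗮ.starProjection x) z ≤ ε} ⊆ O)
    (hG1 : ∀ x ∈ O, G x = 1)
    (hGsupp : tsupport ⇑G ⊆ {x : V | dist (Wᗮ.starProjection x) z < 2 * ε})
    {U₀ : Set V} (hGU₀ : tsupport ⇑G ⊆ U₀) (hχ : ∀ x ∈ U₀, χ x = 1)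
    (g : 𝓓((⊤ : Opens W), ℝ)) (hg : tsupport (g : W → ℝ) ⊆ ball 0 R) :
    Tendsto (fun l => (((blowUpCurrent σ ξ a (lam l)).smulFun G.contDiff).pushforward ⊤ χ
        W.orthogonalProjectionOnto.contDiff) (smulCovectorCLM (frameCovector e) g)) atTop
      (𝓝 ((α : ℝ) * (ξ a) (frameCovector fun i => (e i : V)) *
        ∫ w, g w ∂(volume : Measure W))) := by
  set P := W.orthogonalProjectionOnto with hPdef
  set eV : Fin (k + 1) → V := fun i => (e i : V) with heV
  set c₀ : ℝ := (ξ a) (frameCovector eV) with hc₀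
  -- the test form on `V` against which `T_l` is evaluated
  set frm : TestForm (⊤ : Opens V) (k + 1) :=
    TestForm.smulFun G.contDiff (TestForm.pullback χ P.contDiff (smulCovectorCLM (frameCovector e) g))
    with hfrm
  have heq : ∀ l, (((blowUpCurrent σ ξ a (lam l)).smulFun G.contDiff).pushforward ⊤ χ P.contDiff)
      (smulCovectorCLM (frameCovector e) g) = blowUpCurrent σ ξ a (lam l) frm := fun l => rfl
  refine Tendsto.congr (fun l => (heq l).symm) ?_
  -- the cone limit
  have hlim := tendsto_blowUpCurrent_apply hξ hlam hlam0 hv hLeb frm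
  -- identify the limit
  have hfrmx : ∀ x, frm x = (G x * χ x * g (P x)) • frameCovector eV := by
    intro x
    simp only [hfrm, TestForm.smulFun_apply, TestForm.pullback_apply, smulCovectorCLM_apply,
      ContinuousLinearMap.fderiv, Covector.smul_compContinuousLinearMap, smul_smul]
    rw [← mul_assoc]
    congr 1
    exact frameCovector_compContinuousLinearMap_orthogonalProjectionOnto W e
  set f : V → ℝ := fun x => G x * χ x * g (P x) * c₀ with hf
  have hfx : ∀ x, (ξ a) (frm x) = f x := by
    intro x
    rw [hfrmx x, map_smul, smul_eq_mul, hf]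
  have hfc : Continuous f :=
    ((G.continuous.mul χ.continuous).mul (g.continuous.comp P.continuous)).mul continuous_const
  have hfsupp : support f ⊆ tsupport ⇑G := by
    intro x hx
    by_contra h
    exact hx (by rw [hf]; simp [image_eq_zero_of_notMem_tsupport h])
  have hfcs : HasCompactSupport f :=
    HasCompactSupport.of_support_subset_isCompact G.hasCompactSupport.isCompact hfsupp
  have hval : (vectorCurrent ν (fun _ => ξ a) : Current (⊤ : Opens V) (k + 1)) frm = ∫ x, f x ∂ν := by
    rw [vectorCurrent_apply ((locallyIntegrable_const (ξ a)).locallyIntegrableOn _)]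
    exact integral_congr_ae (Eventually.of_forall hfx)
  -- `f` vanishes off the slab `S = {dist(P_{Wᗮ} x, z) < δ}`
  set S : Set V := {x | dist (Wᗮ.starProjection x) z < δ} with hS
  have hSm : MeasurableSet S :=
    (isOpen_lt (Wᗮ.starProjection.continuous.dist continuous_const) continuous_const).measurableSet
  have hfS : ∀ x ∉ S, f x = 0 := by
    intro x hx
    have hxG : x ∉ tsupport ⇑G := fun h => hx (by
      have h' : dist (Wᗮ.starProjection x) z < 2 * ε := hGsupp h
      rw [hS]
      exact show dist (Wᗮ.starProjection x) z < δ by linarith)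
    by_contra h
    exact hxG (hfsupp h)
  have h1 : ∫ x, f x ∂ν = ∫ x in S, f x ∂ν :=
    (setIntegral_eq_integral_of_forall_compl_eq_zero fun x hx => hfS x hx).symm
  -- on the plane `z + W`, `f = c₀ · g ∘ Π`
  set A : Set V := {x | x - z ∈ W} with hA
  have hAm : MeasurableSet A := by
    have : A = (fun x => x - z) ⁻¹' (W : Set V) := rfl
    rw [this]
    exact (W.closed_of_finiteDimensional.preimage (continuous_id.sub continuous_const)).measurableSet
  have hfA : ∀ x ∈ A, f x = c₀ * g (P x) := by
    intro x hx
    by_cases hgx : g (P x) = 0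
    · simp [hf, hgx]
    have hPx : Wᗮ.starProjection x = z := by
      have hxz : x = z + (x - z) := by abel
      have h2 : Wᗮ.starProjection (x - z) = 0 :=
        Submodule.starProjection_orthogonal_apply_eq_zero hx
      rw [hxz, map_add, h2, add_zero]
      exact Submodule.starProjection_eq_self_iff.2 hz
    have hWx : ‖W.starProjection x‖ ≤ R := by
      have hm : P x ∈ tsupport (g : W → ℝ) := subset_tsupport _ hgx
      have := hg hm
      rw [mem_ball, dist_zero_right] at this
      rw [Submodule.starProjection_apply, Submodule.norm_coe]
      exact this.le
    have hxO : x ∈ O := hKO ⟨hWx, by rw [hPx, dist_self]; exact hε.le⟩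
    have hGx : G x = 1 := hG1 x hxO
    have hχx : χ x = 1 := hχ x (hGU₀ (subset_tsupport _ (by rw [mem_support, hGx]; norm_num)))
    simp [hf, hGx, hχx, mul_comm]
  have h2 : ∫ x in S, f x ∂ν = (α : ℝ) * (c₀ * ∫ w, g w ∂(volume : Measure W)) := by
    rw [show ν.restrict S = (α : ℝ≥0∞) • (μHE[k + 1] : Measure V).restrict A from hsheet,
      integral_smul_measure, ENNReal.coe_toReal, smul_eq_mul,
      setIntegral_congr_fun hAm hfA, integral_const_mul,
      integral_comp_orthogonalProjectionOnto_restrict_plane W hdim hz]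
  rw [hval, h1, h2, ← mul_assoc] at hlim
  exact hlim

/-- **The shell is `ν`-null**: `ν {‖P_W x‖ ≤ R, ε ≤ dist(P_{Wᗮ} x, z) ≤ 2ε} = 0` when
`ν ⌞ {dist(P_{Wᗮ}·, z) < δ} = α 𝓗^{k+1} ⌞ (z + W)` and `2ε < δ`, `ε > 0` (the shell lies in the
slab and misses the plane). [cite: White1989, p. 219] -/
theorem measure_cylinderShell_eq_zero_of_sheet (W : Submodule ℝ V) {z : V} (hz : z ∈ Wᗮ)
    {δ : ℝ} {α : ℝ≥0} {ν : Measure V}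
    (hsheet : ν.restrict {x | dist (Wᗮ.starProjection x) z < δ} =
      (α : ℝ≥0∞) • (μHE[k + 1] : Measure V).restrict {x | x - z ∈ W})
    {ε : ℝ} (hε : 0 < ε) (h2ε : 2 * ε < δ) (R : ℝ) :
    ν {x : V | ‖W.starProjection x‖ ≤ R ∧ ε ≤ dist (Wᗮ.starProjection x) z ∧
      dist (Wᗮ.starProjection x) z ≤ 2 * ε} = 0 := by
  set Ksh : Set V := {x : V | ‖W.starProjection x‖ ≤ R ∧ ε ≤ dist (Wᗮ.starProjection x) z ∧
    dist (Wᗮ.starProjection x) z ≤ 2 * ε} with hKsh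
  have hKshm : MeasurableSet Ksh := (isCompact_cylinderShell W z R ε (2 * ε)).isClosed.measurableSet
  have hsub : Ksh ⊆ {x | dist (Wᗮ.starProjection x) z < δ} := fun x hx => by
    change dist (Wᗮ.starProjection x) z < δ
    linarith [hx.2.2]
  have h1 : ν Ksh = ν.restrict {x | dist (Wᗮ.starProjection x) z < δ} Ksh := by
    rw [Measure.restrict_apply hKshm, inter_eq_self_of_subset_left hsub]
  rw [h1, hsheet, Measure.smul_apply, Measure.restrict_apply hKshm, smul_eq_mul]
  have hempty : Ksh ∩ {x | x - z ∈ W} = ∅ := by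
    refine eq_empty_iff_forall_notMem.2 fun x hx => ?_
    obtain ⟨⟨-, h2, -⟩, hxA⟩ := hx
    have hPx : Wᗮ.starProjection x = z := by
      have hxz : x = z + (x - z) := by abel
      have h3 : Wᗮ.starProjection (x - z) = 0 :=
        Submodule.starProjection_orthogonal_apply_eq_zero hxA
      rw [hxz, map_add, h3, add_zero]
      exact Submodule.starProjection_eq_self_iff.2 hz
    rw [hPx, dist_self] at h2
    linarith
  rw [hempty, measure_empty, mul_zero]

/-- **The projection step of White's closure theorem** [White1989, p. 219: "`𝐌_U(T'_λ − β_λ[U]) ≤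
c 𝐌_U(∂T'_λ) → 0`"; Bandara2006, Lemma 4.1.12 and pp. 43–44]. In the setting of
`tendsto_projectedBlowUp_apply`, with `T = σ ∧ ξ` a cycle, `0 ≤ G ≤ 1`, `|χ| ≤ 1`: for every bounded
measurable `U' ⊆ W` with `cthickening (2ε') U' ⊆ B(0, R)` and every `η > 0`, for all large `l`,
`|Π_#(T_l ⌞ G)(g e^♭) − α c₀ ∫_W g| ≤ η` simultaneously for all test functions `g` on `W` supported in
`U'` with `|g| ≤ 1`. Ingredients: `𝐌(Π_#(T_l ⌞ G)) ≤ ‖T_l‖(spt G)` is eventually bounded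
(`variation_blowUpCurrent_le_add`, vague convergence), the boundaries are `δ_l`-small on `B(0, R)`
with `δ_l = (k+1) ‖dG‖_∞ ‖T_l‖(K_shell) → 0` (`tendsto_variation_blowUpCurrent_of_null`, the shell being
`ν`-null), the weak limit is `α c₀ [W]` on `B(0, R)`, and `TopDimensionalRigidity`.
[cite: White1989, p. 219; Bandara2006, Lemma 4.1.12] -/
theorem eventually_forall_abs_projectedBlowUp_sub_le (hξ : Integrable ξ σ)
    (hT : (vectorCurrent σ ξ : Current (⊤ : Opens V) (k + 1)).boundary = 0)
    (hlam : ∀ l, 0 < lam l) (hlam0 : Tendsto lam atTop (𝓝 0))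
    (hv : Measure.VagueTendsto (fun l => Measure.blowUp σ (k + 1) a (lam l)) ν)
    (hLeb : Tendsto (fun r => (r⁻¹) ^ (k + 1) * ∫ x in closedBall a r, ‖ξ x - ξ a‖ ∂σ)
      (𝓝[>] 0) (𝓝 0))
    (W : Submodule ℝ V) (hdim : Module.finrank ℝ W = k + 1)
    (e : OrthonormalBasis (Fin (k + 1)) ℝ W)
    {z : V} (hz : z ∈ Wᗮ) {δ : ℝ} {α : ℝ≥0}
    (hsheet : ν.restrict {x | dist (Wᗮ.starProjection x) z < δ} =
      (α : ℝ≥0∞) • (μHE[k + 1] : Measure V).restrict {x | x - z ∈ W})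
    {ε R : ℝ} (hε : 0 < ε) (h2ε : 2 * ε < δ) (G χ : 𝓓((⊤ : Opens V), ℝ))
    (hG01 : ∀ x, G x ∈ Icc (0 : ℝ) 1) {O : Set V} (hO : IsOpen O)
    (hKO : {x : V | ‖W.starProjection x‖ ≤ R ∧ dist (Wᗮ.starProjection x) z ≤ ε} ⊆ O)
    (hG1 : ∀ x ∈ O, G x = 1)
    (hGsupp : tsupport ⇑G ⊆ {x : V | dist (Wᗮ.starProjection x) z < 2 * ε})
    {U₀ : Set V} (hU₀ : IsOpen U₀) (hGU₀ : tsupport ⇑G ⊆ U₀) (hχ : ∀ x ∈ U₀, χ x = 1)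
    (hχ1 : ∀ x, |χ x| ≤ 1)
    {U' : Set W} (hU'm : MeasurableSet U') (hU'b : Bornology.IsBounded U') {ε' : ℝ} (hε' : 0 < ε')
    (hU'U : cthickening (2 * ε') U' ⊆ ball (0 : W) R) {η : ℝ} (hη : 0 < η) :
    ∀ᶠ l in atTop, ∀ g : 𝓓((⊤ : Opens W), ℝ), tsupport (g : W → ℝ) ⊆ U' → (∀ y, |g y| ≤ 1) →
      |(((blowUpCurrent σ ξ a (lam l)).smulFun G.contDiff).pushforward ⊤ χ
          W.orthogonalProjectionOnto.contDiff) (smulCovectorCLM (frameCovector e) g) -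
        (α : ℝ) * (ξ a) (frameCovector fun i => (e i : V)) * ∫ y, g y ∂(volume : Measure W)| ≤ η := by
  set P := W.orthogonalProjectionOnto with hPdef
  set T : ℕ → Current (⊤ : Opens V) (k + 1) := fun l => blowUpCurrent σ ξ a (lam l) with hTdef
  set S : ℕ → Current (⊤ : Opens W) (k + 1) :=
    fun l => ((T l).smulFun G.contDiff).pushforward ⊤ χ P.contDiff with hSdef
  set β : ℝ := (α : ℝ) * (ξ a) (frameCovector fun i => (e i : V)) with hβ
  have hTm : ∀ l, (T l).mass ≠ ⊤ := fun l => mass_blowUpCurrent_ne_top hξ a (hlam l)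
  have hTcyc : ∀ l, (T l).boundary = 0 := fun l => boundary_blowUpCurrent_eq_zero hξ hT a (hlam l)
  -- Step 1: masses are eventually bounded
  set K₂ : Set V := tsupport ⇑G with hK₂
  have hK₂c : IsCompact K₂ := G.hasCompactSupport
  obtain ⟨E, hE0, hE⟩ := variation_blowUpCurrent_le_add (σ := σ) (ξ := ξ) (a := a) hξ hlam hlam0
    hLeb hK₂c
  have hνK₂ : ν K₂ < ⊤ := hK₂c.measure_lt_top
  have hev1 : ∀ᶠ l in atTop, Measure.blowUp σ (k + 1) a (lam l) K₂ < ν K₂ + 1 :=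
    eventually_lt_of_limsup_lt
      ((hv.limsup_measure_le_of_isCompact hK₂c).trans_lt (ENNReal.lt_add_right hνK₂.ne one_ne_zero))
  have hev2 : ∀ᶠ l in atTop, E l ≤ 1 := by
    have : (Set.Iic (1 : ℝ≥0∞)) ∈ 𝓝 (0 : ℝ≥0∞) := Iic_mem_nhds zero_lt_one
    exact hE0.eventually this
  set C : ℝ≥0∞ := ‖ξ a‖ₑ * (ν K₂ + 1) + 1 with hC
  have hCtop : C ≠ ⊤ := ENNReal.add_ne_top.2
    ⟨ENNReal.mul_ne_top enorm_ne_top (ENNReal.add_ne_top.2 ⟨hνK₂.ne, ENNReal.one_ne_top⟩), ENNReal.one_ne_top⟩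
  have hevM : ∀ᶠ l in atTop, (S l).mass ≤ C := by
    filter_upwards [hev1, hev2] with l h1 h2
    calc (S l).mass ≤ (T l).variation K₂ :=
          Current.mass_pushforward_smulFun_le W (T l) (hTm l) G χ hG01 hχ1
      _ ≤ ‖ξ a‖ₑ * Measure.blowUp σ (k + 1) a (lam l) K₂ + E l := hE l
      _ ≤ ‖ξ a‖ₑ * (ν K₂ + 1) + 1 := by gcongr
  obtain ⟨N, hN⟩ := eventually_atTop.1 hevM
  -- Step 2: boundaries are `δ_l`-small on `B(0, R)`, `δ_l → 0`
  set Ksh : Set V := {x : V | ‖W.starProjection x‖ ≤ R ∧ ε ≤ dist (Wᗮ.starProjection x) z ∧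
    dist (Wᗮ.starProjection x) z ≤ 2 * ε} with hKsh
  have hKshc : IsCompact Ksh := isCompact_cylinderShell W z R ε (2 * ε)
  have hKsh0 : ν Ksh = 0 := measure_cylinderShell_eq_zero_of_sheet W hz hsheet hε h2ε R
  have hGd : Continuous (fderiv ℝ (G : V → ℝ)) := G.contDiff.continuous_fderiv (by simp)
  obtain ⟨B, hB⟩ := (G.hasCompactSupport.fderiv (𝕜 := ℝ)).exists_bound_of_continuous hGd
  set δs : ℕ → ℝ := fun l => (k + 1) * B * ((T l).variation Ksh).toReal with hδs
  have hδs0 : Tendsto δs atTop (𝓝 0) := by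
    have h1 := tendsto_variation_blowUpCurrent_of_null hξ hlam hlam0 hv hLeb hKshc hKsh0
    have h2 : Tendsto (fun l => ((T l).variation Ksh).toReal) atTop (𝓝 0) := by
      have := (ENNReal.tendsto_toReal ENNReal.zero_ne_top).comp h1
      rwa [ENNReal.toReal_zero] at this
    have h3 := h2.const_mul ((k + 1 : ℝ) * B)
    rw [mul_zero] at h3
    exact h3
  have hbd : ∀ l (ψ : TestForm (⊤ : Opens W) k) (C' : ℝ), tsupport ⇑ψ ⊆ ball (0 : W) R →
      (∀ y, ‖ψ y‖ ≤ C') → |(S l).boundary ψ| ≤ δs l * C' := fun l ψ C' hψU hψC =>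
    Current.abs_boundary_pushforward_smulFun_le W (T l) (hTm l) (hTcyc l) G χ hO hKO hG1 hGsupp hU₀
      hGU₀ hχ hχ1 hB ψ hψU hψC
  -- Step 3: the weak limit on `B(0, R)`
  have hweak : ∀ φ : 𝓓((⊤ : Opens W), ℝ), tsupport (φ : W → ℝ) ⊆ ball (0 : W) R →
      Tendsto (fun l => S l (smulCovectorCLM (frameCovector e) φ)) atTop
        (𝓝 (β * ∫ y, φ y ∂volume)) := fun φ hφ =>
    tendsto_projectedBlowUp_apply hξ hlam hlam0 hv hLeb W hdim e hz hsheet hε h2ε G χ hKO hG1 hGsupp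
      hGU₀ hχ φ hφ
  -- Step 4: shift the sequence by `N` and apply the rigidity theorem
  have hmass' : ∀ j, (S (j + N)).mass ≤ C := fun j => hN _ (Nat.le_add_left N j)
  have hδ' : Tendsto (fun j => δs (j + N)) atTop (𝓝 0) := hδs0.comp (tendsto_add_atTop_nat N)
  have hbd' : ∀ j (ψ : TestForm (⊤ : Opens W) k) (C' : ℝ), tsupport ⇑ψ ⊆ ball (0 : W) R →
      (∀ y, ‖ψ y‖ ≤ C') → |(S (j + N)).boundary ψ| ≤ δs (j + N) * C' := fun j => hbd (j + N)
  have hweak' : ∀ φ : 𝓓((⊤ : Opens W), ℝ), tsupport (φ : W → ℝ) ⊆ ball (0 : W) R →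
      Tendsto (fun j => S (j + N) (smulCovectorCLM (frameCovector e) φ)) atTop
        (𝓝 (β * ∫ y, φ y ∂volume)) := fun φ hφ => (hweak φ hφ).comp (tendsto_add_atTop_nat N)
  have h := eventually_forall_abs_apply_sub_const_integral_le e (fun j => S (j + N)) hCtop hmass'
    (fun j => δs (j + N)) hδ' hbd' β hweak' hU'm hU'b hε' hU'U hη
  obtain ⟨J, hJ⟩ := eventually_atTop.1 h
  refine eventually_atTop.2 ⟨J + N, fun l hl g hgU' hg1 => ?_⟩
  have := hJ (l - N) (by omega) g hgU' hg1
  simp only [hSdef, hTdef] at this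
  rwa [Nat.sub_add_cancel (by omega)] at this

end Projected

end Literature.Geometry.GeometricMeasureTheory
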